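import Literature.AlgebraicGeometry.Modules.LocallyFreeTrace
import HarnessLib

/-!
# The trace of a finite locally free `𝒪_X`-module: restriction, cyclicity `tr(αβ) = tr(βα)`, and rank-one endomorphisms

Sequel to `Modules/LocallyFreeTrace.lean` (the trace `tr : 𝓔nd(E) = 𝓗om(E, E) → 𝒪_X` of a finite locally free
`𝒪_X`-module, glued from the frame sums `∑_i λ_i(φ(b_i))`). Bourbaki, *Algebra* II §4 no. 3 (the trace of an
endomorphism of a finitely generated projective module as the contraction `E^* ⊗ E → C`, (16)–(17)
`Tr(x^* ⊗ x) = ⟨x, x^*⟩`; Prop. 3 (20) `Tr(v ∘ u) = Tr(u ∘ v)` for `u : E → F`, `v : F → E`), read on the SECTIONS over an open `U ⊆ X` of the tree's sheaf-level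
trace (`(trace hE).app U φ ∈ Γ(X, U)` for `φ : E|_U → E|_U`):

* `map_trace_app` — the trace commutes with restriction to smaller opens (`tr(φ)|_V = tr(φ|_V)`);
* `trace_app_comp_comm` — **cyclicity `tr_M(α ≫ β) = tr_N(β ≫ α)`** for `α : M|_U → N|_U`, `β : N|_U → M|_U` between two
  finite locally free modules (on a common framed open it is `∑_{i,j} a_{ij} b_{ji} = ∑_{j,i} b_{ji} a_{ij}`; glue by the
  sheaf property of `𝒪_X`);
* `smulSection_comp`, `smulSection_comp_eq_overScalar` — bookkeeping for the rank-one morphisms `λ ≫ (· s)`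
  (`smulSection`, `Modules/LocalFrames`): `(· b) ≫ ψ = (· ψ(b))`, `(· s) ≫ λ = λ(s) · 𝟙_{𝒪|_U}`;
* `trace_app_dual_comp_smulSection` — **the trace of a rank-one endomorphism: `tr(λ ≫ (· s)) = λ(s)`** for a section
  `s ∈ Γ(E, U)` and a linear form `λ : E|_U → 𝒪|_U`.

Everything is proved; no named facts. Motivation: transitivity of the trace along a finite morphism
(`Modules/PushforwardTraceTransitive`), where an endomorphism over an affine open is a sum of rank-one ones.

## References

* N. Bourbaki, *Algebra I, Chapters 1–3* (1974/1989), II §4 no. 3 (trace of an endomorphism: (16)–(17) `Tr(x^* ⊗ x) = ⟨x, x^*⟩`; Prop. 3 (20) `Tr(v ∘ u) = Tr(u ∘ v)` for `u : E → F`, `v : F → E` finitely generated projective), held text `book:bourbakind-algebra` p. 373. [BourbakiAlgebraI1989]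
* R. Hartshorne, *Algebraic Geometry*, GTM 52 (1977), II Ex. 5.1 (a), (b) (p. 123). [Hartshorne1977]
-/

noncomputable section

open CategoryTheory AlgebraicGeometry Opposite TopologicalSpace Limits

namespace Literature.AlgebraicGeometry.Modules

open Literature.AlgebraicGeometry.Motives

universe u

variable {X : Scheme.{u}}

/-! ### The trace and restriction -/

section Restrict

variable {E : X.Modules} (hE : IsFiniteLocallyFree E) {U V : X.Opens}

/-- **The trace commutes with restriction**: `tr(φ)|_V = tr(φ|_V)` for `φ : E|_U → E|_U` and `V ≤ U` (naturality of the
morphism of sheaves `trace hE`; the restriction of `𝓗om(E, E)` is `restrictHom`). [cite: BourbakiAlgebraI1989, II §4 no. 3 (17)] -/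
theorem map_trace_app (k : V ⟶ U) (φ : E.over U ⟶ E.over U) :
    X.presheaf.map k.op ((trace hE).app U φ) = (trace hE).app V (restrictHom k φ) :=
  (Scheme.Modules.Hom.app_map_apply (trace hE) k φ).symm

end Restrict

/-- In `Γ(𝒪_X, W)` the module action of `Γ(X, W)` is multiplication, which is commutative. [folklore] -/
private theorem smul_unit_comm {W : X.Opens} (a b : Γ(X, W)) :
    (a • (show Γ(unitModule X, W) from b)) = b • (show Γ(unitModule X, W) from a) :=
  mul_comm a b

/-! ### Cyclicity `tr(αβ) = tr(βα)` -/

section Cyclic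

open scoped Classical

variable {M N : X.Modules} (hM : IsFiniteLocallyFree M) (hN : IsFiniteLocallyFree N) {U W : X.Opens}

/-- Cyclicity on a COMMON FRAMED open: with frames `(b_i, λ_i)` of `M|_W` and `(c_j, μ_j)` of `N|_W`,
`tr_M(αβ) = ∑_i λ_i(β(α b_i)) = ∑_{i,j} μ_j(α b_i) λ_i(β c_j) = ∑_j μ_j(α(β c_j)) = tr_N(βα)`. [cite: BourbakiAlgebraI1989, II §4 no. 3 Prop. 3 (20)] -/
theorem trace_app_comp_comm_of_frames {I J : Type u} [Fintype I] [Fintype J]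
    (eM : SheafOfModules.free I ≅ M.over W) (eN : SheafOfModules.free J ≅ N.over W)
    (α : M.over W ⟶ N.over W) (β : N.over W ⟶ M.over W) :
    (trace hM).app W (α ≫ β) = (trace hN).app W (β ≫ α) := by
  rw [trace_app_eq_sum hM eM, trace_app_eq_sum hN eN]
  -- the two matrices `a i j = μ_j(α b_i)`, `b j i = λ_i(β c_j)`
  have hL : ∀ i, appLE (dualBasis eM i) (𝟙 W) (appLE (α ≫ β) (𝟙 W) (basisSection eM i)) =
      ∑ j, coord eN (𝟙 W) (appLE α (𝟙 W) (basisSection eM i)) j *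
        coord eM (𝟙 W) (appLE β (𝟙 W) (basisSection eN j)) i := by
    intro i
    rw [appLE_comp, appLE_eq_sum_coord eN β (𝟙 W) (appLE α (𝟙 W) (basisSection eM i))]
    simp only [presheaf_map_id]
    rw [appLE_sum_right]
    refine Finset.sum_congr rfl fun j _ => ?_
    rw [appLE_smul_right, ← coord_def]
    rfl
  have hR : ∀ j, appLE (dualBasis eN j) (𝟙 W) (appLE (β ≫ α) (𝟙 W) (basisSection eN j)) =
      ∑ i, coord eM (𝟙 W) (appLE β (𝟙 W) (basisSection eN j)) i *
        coord eN (𝟙 W) (appLE α (𝟙 W) (basisSection eM i)) j := by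
    intro j
    rw [appLE_comp, appLE_eq_sum_coord eM α (𝟙 W) (appLE β (𝟙 W) (basisSection eN j))]
    simp only [presheaf_map_id]
    rw [appLE_sum_right]
    refine Finset.sum_congr rfl fun i _ => ?_
    rw [appLE_smul_right, ← coord_def]
    rfl
  simp_rw [hL, hR]
  refine Finset.sum_comm.trans ?_
  exact Finset.sum_congr rfl fun j _ => Finset.sum_congr rfl fun i _ =>
    mul_comm (coord eN (𝟙 W) (appLE α (𝟙 W) (basisSection eM i)) j) _

/-- **Cyclicity of the trace: `tr_M(α ≫ β) = tr_N(β ≫ α)`** in `Γ(X, U)`, for `α : M|_U → N|_U`, `β : N|_U → M|_U` between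
finite locally free modules (compare the two sections of `𝒪_X` on the cover of `U` by opens where both `M` and `N` are
framed, `trace_app_comp_comm_of_frames`). [cite: BourbakiAlgebraI1989, II §4 no. 3 Prop. 3 (20)] [cite: Hartshorne1977, II Ex. 5.1] -/
theorem trace_app_comp_comm (α : M.over U ⟶ N.over U) (β : N.over U ⟶ M.over U) :
    (trace hM).app U (α ≫ β) = (trace hN).app U (β ≫ α) := by
  refine TopCat.Sheaf.eq_of_locally_eq' (X.sheaf : TopCat.Sheaf CommRingCat X)
    (fun x : U => (U ⊓ trivNbhd hM x.1) ⊓ trivNbhd hN x.1) U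
    (fun x => homOfLE (inf_le_left.trans inf_le_left)) ?_ _ _ fun x => ?_
  · intro y hy
    exact Opens.mem_iSup.2 ⟨⟨y, hy⟩, ⟨hy, mem_trivNbhd hM y⟩, mem_trivNbhd hN y⟩
  · set W : X.Opens := (U ⊓ trivNbhd hM x.1) ⊓ trivNbhd hN x.1
    have kM : W ≤ trivNbhd hM x.1 := inf_le_left.trans inf_le_right
    have kN : W ≤ trivNbhd hN x.1 := inf_le_right
    let eM := SheafOfModules.restrictTrivialisation (R := X.ringCatSheaf) (homOfLE kM) (trivFrame hM x.1)
    let eN := SheafOfModules.restrictTrivialisation (R := X.ringCatSheaf) (homOfLE kN) (trivFrame hN x.1)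
    change X.presheaf.map (homOfLE _).op ((trace hM).app U (α ≫ β)) =
      X.presheaf.map (homOfLE _).op ((trace hN).app U (β ≫ α))
    rw [map_trace_app, map_trace_app, restrictHom_comp, restrictHom_comp]
    exact trace_app_comp_comm_of_frames hM hN eM eN _ _

end Cyclic

/-! ### Rank-one morphisms `λ ≫ (· s)` and their trace -/

section RankOne

open scoped Classical

variable {E M N : X.Modules} {U W V : X.Opens}

/-- `(· b) ≫ ψ = (· ψ(b))`: post-composing the multiplication-by-a-section map with `ψ : E|_U → M|_U` (bookkeeping for the rank-one
maps `x ↦ ⟨x, a^*⟩ b` of the proof of Prop. 3). [cite: BourbakiAlgebraI1989, II §4 no. 3 (proof of Prop. 3)] -/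
theorem smulSection_comp (b : Γ(E, U)) (ψ : E.over U ⟶ M.over U) :
    smulSection b ≫ ψ = smulSection (appLE ψ (𝟙 U) b) := by
  refine hom_ext_of_appLE fun W k r => ?_
  rw [appLE_comp, appLE_smulSection, appLE_smulSection, appLE_smul_right, ← appLE_map ψ (𝟙 U) k b,
    Category.comp_id]

/-- `(· s) ≫ λ = λ(s) · 𝟙` on `𝒪|_U`: a linear form after multiplication by a section is the scalar `λ(s)` (the composite
`y ↦ ⟨y, b^*⟩ a ↦ ⟨a, a^*⟩⟨y, b^*⟩` of the proof of Prop. 3, case `E = C`). [cite: BourbakiAlgebraI1989, II §4 no. 3 (proof of Prop. 3)] -/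
theorem smulSection_comp_eq_overScalar (s : Γ(E, U)) (lam : E.over U ⟶ (unitModule X).over U) :
    smulSection s ≫ lam = overScalar (unitModule X) U (appLE lam (𝟙 U) s) := by
  refine hom_ext_of_appLE fun W k r => ?_
  have h := appLE_map lam (𝟙 U) k s
  rw [Category.comp_id] at h
  rw [appLE_comp, appLE_smulSection, appLE_smul_right, appLE_overScalar, h]
  exact smul_unit_comm _ _

variable (hE : IsFiniteLocallyFree E)

/-- The trace of a rank-one endomorphism on a FRAMED open: `∑_i λ_i(λ(b_i) s) = λ(∑_i λ_i(s) b_i) = λ(s)`. [cite: BourbakiAlgebraI1989, II §4 no. 3 (16)–(17)] -/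
theorem trace_app_dual_comp_smulSection_of_frame {I : Type u} [Fintype I] (e : SheafOfModules.free I ≅ E.over W)
    (s : Γ(E, W)) (lam : E.over W ⟶ (unitModule X).over W) :
    (trace hE).app W (lam ≫ smulSection s) = appLE lam (𝟙 W) s := by
  rw [trace_app_eq_sum hE e]
  conv_rhs => rw [eq_sum_coord_smul e (𝟙 W) s, appLE_sum_right]
  refine Finset.sum_congr rfl fun i _ => ?_
  rw [appLE_comp, appLE_smulSection, presheaf_map_id, appLE_smul_right, presheaf_map_id, appLE_smul_right,
    coord_def]
  exact smul_unit_comm _ _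

/-- **The trace of a rank-one endomorphism: `tr(λ ≫ (· s)) = λ(s)`** in `Γ(X, U)`, for a section `s ∈ Γ(E, U)` and a linear
form `λ : E|_U → 𝒪|_U` of a finite locally free `E` (`Tr(x^* ⊗ x) = ⟨x, x^*⟩`; compare on the framed cover of `U`).
[cite: BourbakiAlgebraI1989, II §4 no. 3 (16)–(17)] [cite: Hartshorne1977, II Ex. 5.1 (b)] -/
theorem trace_app_dual_comp_smulSection (s : Γ(E, U)) (lam : E.over U ⟶ (unitModule X).over U) :
    (trace hE).app U (lam ≫ smulSection s) = appLE lam (𝟙 U) s := by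
  refine TopCat.Sheaf.eq_of_locally_eq' (X.sheaf : TopCat.Sheaf CommRingCat X)
    (fun x : U => U ⊓ trivNbhd hE x.1) U (fun x => Opens.infLELeft _ _) (le_iSup_piece hE) _ _ fun x => ?_
  change X.presheaf.map (Opens.infLELeft _ _).op ((trace hE).app U (lam ≫ smulSection s)) =
    X.presheaf.map (Opens.infLELeft _ _).op (appLE lam (𝟙 U) s)
  rw [map_trace_app, restrictHom_comp]
  have hs : restrictHom (Opens.infLELeft U (trivNbhd hE x.1)) (smulSection s) =
      smulSection (E.presheaf.map (Opens.infLELeft U (trivNbhd hE x.1)).op s) := by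
    refine hom_ext_of_appLE fun W k r => ?_
    rw [appLE_restrictHom, appLE_smulSection, appLE_smulSection, presheaf_map_map]
  have h2 := appLE_map lam (𝟙 U) (Opens.infLELeft U (trivNbhd hE x.1)) s
  rw [Category.comp_id] at h2
  rw [hs, trace_app_dual_comp_smulSection_of_frame hE (pieceFrame hE x), appLE_restrictHom, Category.id_comp, h2]
  rfl

end RankOne

end Literature.AlgebraicGeometry.Modules

end
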